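import Summits.Parity.GeneralizedHardyLittlewood.Theses.LiouvilleMAD
import Summits.Parity.GeneralizedHardyLittlewood.Theses.LiouvilleShiftedTables
import Summits.Parity.GeneralizedHardyLittlewood.Theses.DicksonFibration
import Summits.Parity.GeneralizedHardyLittlewood.Theorems.LiouvilleShiftedTablesMAvgOfLevel

/-!
# Sketch — crux-ideate stmt-Parity-14995 (`EngineToGHL`, route LiouvilleMAD), ideator 1, round 1

§1  Structure of the crux (kernel-checked): `EngineToGHL` is DEFINITIONALLY
    `Glue ∧ Residual` with `Glue := DecorrelationToDilatedChowla ∧ DilatedChowlaToTypeII ∧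
    TypeIIToLevel ∧ LevelToPairs` (the route's four support items) and
    `Residual := LiouvilleShiftedTables.PairsToGHL` (the shared item stmt-Parity-9389) BY NAME.
    Hence the crux inherits 9389's standing Disproof.lean and its disposition
    (`EngineToGHL → PairsToGHL`, and `PairsToGHL` is `DimOne`-hard modulo the fibration lemma).
§2  First lemmas of the idea card `glue-now-residual-by-name` as `Prop`s over existing
    declarations: the Type-I dispatch junction of conjunct 3 and the singular-series junction of
    conjunct 4.
-/

namespace Summit.Parity.GeneralizedHardyLittlewood.Cruxes.EngineToGHL.GlueNowResidualByName

open Summit.Parity.GeneralizedHardyLittlewood.Theses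
open Summit.Parity.GeneralizedHardyLittlewood.Theses.LiouvilleMAD
open Filter

/-! ## §1 The crux is `Glue ∧ Residual`, residual = the shared item by name -/

/-- `EngineToGHL` unfolds to the conjunction of the four support items of route LiouvilleMAD and
the shared statement `LiouvilleShiftedTables.PairsToGHL` (stmt-Parity-9389) — by `Iff.rfl`. -/
theorem engineToGHL_iff_glue_and_residual :
    EngineToGHL ↔
      (DecorrelationToDilatedChowla ∧ DilatedChowlaToTypeII ∧ TypeIIToLevel ∧ LevelToPairs ∧
        LiouvilleShiftedTables.PairsToGHL) :=
  Iff.rfl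

/-- The composition a line for this crux has to end in: four glue stubs and the residual. -/
theorem engineToGHL_of (g₁ : DecorrelationToDilatedChowla) (g₂ : DilatedChowlaToTypeII)
    (g₃ : TypeIIToLevel) (g₄ : LevelToPairs) (hR : LiouvilleShiftedTables.PairsToGHL) :
    EngineToGHL :=
  ⟨g₁, g₂, g₃, g₄, hR⟩

/-- The crux dominates the shared residual: any proof of `EngineToGHL` proves stmt-Parity-9389. -/
theorem pairsToGHL_of_engineToGHL (h : EngineToGHL) : LiouvilleShiftedTables.PairsToGHL :=
  h.2.2.2.2

/-- … and the residual is the summit conjunct as soon as binary Hardy–Littlewood holds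
(`PairsHL` = the conclusion of conjunct 4). -/
theorem ghl_of_engineToGHL_of_pairsHL (h : EngineToGHL) (hP : LiouvilleShiftedTables.PairsHL) :
    GeneralizedHardyLittlewood :=
  h.2.2.2.2 hP

/-- Under the route's other hypotheses the crux is literally equivalent to the summit conjunct. -/
theorem engineToGHL_iff_ghl_of_hyps (h₁ : CosetDecorrelation) (h₂ : FanDecorrelation)
    (hEH : ElliottHalberstam) (g₁ : DecorrelationToDilatedChowla) (g₂ : DilatedChowlaToTypeII)
    (g₃ : TypeIIToLevel) (g₄ : LevelToPairs) :
    EngineToGHL ↔ GeneralizedHardyLittlewood :=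
  ⟨fun h => h.2.2.2.2 (g₄ (g₃ (g₂ (g₁ h₁ h₂))) hEH), fun hG => ⟨g₁, g₂, g₃, g₄, fun _ => hG⟩⟩

/-- With the fibration lemma of route DicksonFibration (its assembly item stmt-Parity-0822,
`DimOne → GeneralizedHardyLittlewood`), the residual — hence the crux — is implied by `DimOne`
(stmt-Parity-0819); this is the hold recommended for 9389 and inherited here. -/
theorem engineToGHL_of_dimOne (g₁ : DecorrelationToDilatedChowla) (g₂ : DilatedChowlaToTypeII)
    (g₃ : TypeIIToLevel) (g₄ : LevelToPairs) (hF : DicksonFibration.Assembly)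
    (hD : DicksonFibration.DimOne) : EngineToGHL :=
  ⟨g₁, g₂, g₃, g₄, fun _ => hF hD⟩

/-! ## §2 First lemmas of the glue line (statements only; `Prop`s over existing declarations) -/

/-- **Type-I dispatch** (the conjunct-3 junction named in the crux's `why it might fail`):
Type-I pieces of Vaughan's identity inside the classes `n ≡ w_q (mod q)`, `q ≤ N^{ε₀}`, with the
outer variable `t ≤ N^{6ε₀}` and `1`-bounded coefficients, are `≪_A N (log N)^{-A}` — because for
each `(t, q)` the inner sum is a Liouville sum over ONE class modulo `lcm(t,q) ≤ N^{7ε₀} ≤ N^{1/2-ε}`,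
the tree's `BVLiouville` (all residues, one height per modulus ⇔ max form) applies, and the
multiplicity `#{(t,q) : lcm(t,q) = r} ≤ τ(r²) ≤ τ(r)²` is absorbed by Cauchy–Schwarz against the
trivial bound. -/
def TypeIDispatch : Prop :=
  ∀ h : ℤ, h ≠ 0 → ∀ ε₀ : ℝ, 0 < ε₀ → ε₀ ≤ 1 / 16 → ∀ A : ℝ, 0 < A → ∃ C : ℝ, ∃ N₀ : ℕ,
    ∀ N : ℕ, N₀ ≤ N → ∀ w y : ℕ → ℕ, (∀ q, y q ≤ N) → ∀ a : ℕ → ℝ, (∀ t, |a t| ≤ 1) →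
      (∑ q ∈ Finset.Icc 1 ⌊(N : ℝ) ^ ε₀⌋₊,
        |∑ t ∈ Finset.Icc 1 ⌊(N : ℝ) ^ (6 * ε₀)⌋₊, a t *
          ∑ r ∈ (Finset.Icc 1 (y q / t)).filter (fun r : ℕ => t * r ≡ w q [MOD q]),
            (ArithmeticFunction.liouville (Int.toNat ((t : ℤ) * r + h)) : ℝ)|) ≤
        C * N / Real.log N ^ A

/-- **Type-II in classes** (conjunct 3, bilinear pieces): `TypeIILiouville` transported into the
classes `mk ≡ w (mod q)` — splitting `m` by residues costs only `√(∑_k β_k² gcd(k,q)) ≤ √τ(q)·…`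
after Cauchy–Schwarz over the residue of `m`, so the saving `K^{-1/2} + M^{-η}` survives summation
over `q ≤ N^{ε₀}` once `K ≥ N^{3ε₀}` and `ε₀ < η/2`. Stated for one dyadic box and one modulus. -/
def TypeIIClasses : Prop :=
  TypeIILiouville → ∀ c : ℤ, c ≠ 0 → ∃ η : ℝ, 0 < η ∧ ∃ C : ℝ, ∀ M K q : ℕ, 1 ≤ K → K ≤ M → 1 ≤ q →
    ∀ w : ℕ, ∀ α β : ℕ → ℝ,
      |∑ m ∈ Finset.Ioc M (2 * M), ∑ k ∈ (Finset.Ioc K (2 * K)).filter (fun k : ℕ => m * k ≡ w [MOD q]),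
          α m * β k * (ArithmeticFunction.liouville (Int.toNat ((m : ℤ) * k + c)) : ℝ)| ≤
        C * Real.sqrt (∑ m ∈ Finset.Ioc M (2 * M), α m ^ 2) *
          Real.sqrt (∑ k ∈ Finset.Ioc K (2 * K), (Nat.gcd k q : ℝ) * β k ^ 2) *
          Real.sqrt ((M : ℝ) * K) * ((K : ℝ) ^ (-(1 / 2 : ℝ)) + (M : ℝ) ^ (-η))

/-- **Singular-series identity** (the conjunct-4 junction): for `h ≥ 1`,
`-∑_{d ≤ D, (d,h)=1} μ(d) log d / φ(d) → 𝔖({0,h})` as `D → ∞` (Vatwani 2016, Lemma p.180 for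
`h = 2`; Newman 1980; both sides vanish for odd `h`). -/
def SingularSeriesIdentity : Prop :=
  ∀ h : ℕ, 1 ≤ h →
    Tendsto (fun D : ℕ => -∑ d ∈ (Finset.Icc 1 D).filter (fun d : ℕ => Nat.Coprime d h),
        (ArithmeticFunction.moebius d : ℝ) * Real.log d / (Nat.totient d : ℝ))
      atTop (nhds (Literature.NumberTheory.Sieve.singularSeries ({0, (h : ℤ)} : Finset ℤ)))

/-- **Coprime Möbius over totients** (conjunct 4, the `N log N` cancellation): for `h ≥ 1` and
every `A`, `∑_{d ≤ D, (d,h)=1} μ(d)/φ(d) ≪_A (log D)^{-A}` (from Siegel–Walfisz for `μ`, tree: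
`SiegelWalfiszMoebius_holds`, by the convolution `1_{(d,h)=1} d/φ(d) = ∑_{k ∣ d} g_h(k)`). -/
def CoprimeMoebiusTotient : Prop :=
  ∀ h : ℕ, 1 ≤ h → ∀ A : ℝ, 0 < A → ∃ C : ℝ, ∀ D : ℕ, 2 ≤ D →
    |∑ d ∈ (Finset.Icc 1 D).filter (fun d : ℕ => Nat.Coprime d h),
        (ArithmeticFunction.moebius d : ℝ) / (Nat.totient d : ℝ)| ≤ C / Real.log D ^ A

/-! ## §3 Conjunct 4 rides the sister route's rails

`LevelToPairs` (conjunct 4) factors EXACTLY through the shared support item `PairsFromMAvg`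
(stmt-Parity-14275 of LiouvilleShiftedTables, parts 2–9 landed in Theorems/) and the PROVED tree
theorem `MAvg_of_sum_abs_vonMangoldt_mul_liouville_progressions_le`: the only new piece is the
S-sized bridge `LambdaLiouvilleLevel → LevelHypothesis` (shift `-h`, residue `h`, height `X`,
`A = 6`), proved below. -/

/-- The `ℓ¹`-level hypothesis in the exact shape consumed by the tree theorem
`Theorems.MAvg.MAvg_of_sum_abs_vonMangoldt_mul_liouville_progressions_le`. -/
def LevelHypothesis : Prop :=
  ∀ h : ℕ, 1 ≤ h → ∃ ε : ℝ, 0 < ε ∧ ∃ A : ℝ, 5 < A ∧ ∃ C X₀ : ℝ, ∀ X : ℝ, X₀ ≤ X →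
    ∑ q ∈ Finset.Icc 1 ⌊X ^ (2 * ε)⌋₊,
        |∑ n ∈ (Finset.Ioc h ⌊X⌋₊).filter (fun n => n ≡ h [MOD q]),
          ArithmeticFunction.vonMangoldt n * (ArithmeticFunction.liouville (n - h) : ℝ)|
      ≤ C * X / Real.log X ^ A

/-- The route's bridge premise spelled two ways: `LiouvilleShiftedTables.EH` (stmt-Parity-11314,
the hypothesis of `PairsFromMAvg`) IS `LiouvilleMAD.ElliottHalberstam` (stmt-Parity-14092). -/
theorem eh_iff_elliottHalberstam : LiouvilleShiftedTables.EH ↔ ElliottHalberstam := Iff.rfl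

/-- **Bridge** (S): `LambdaLiouvilleLevel` (all residues, all heights, every `A`, level `N^{ε₀}`)
implies the single-residue, single-height, `A = 6` level hypothesis at level `X^{ε₀/2}`. -/
theorem levelHypothesis_of_lambdaLiouvilleLevel (hL : LambdaLiouvilleLevel) : LevelHypothesis := by
  intro h hh
  have hh0 : (h : ℤ) ≠ 0 := by exact_mod_cast Nat.one_le_iff_ne_zero.mp hh
  obtain ⟨ε₀, hε₀, hA⟩ := hL (-(h : ℤ)) (neg_ne_zero.mpr hh0)
  obtain ⟨C, N₀, hC⟩ := hA 6 (by norm_num)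
  refine ⟨ε₀ / 4, by positivity, 6, by norm_num, 64 * max C 0, max (max (N₀ : ℝ) 4) (h : ℝ), ?_⟩
  intro X hX
  have hXN₀ : (N₀ : ℝ) ≤ X := le_trans (le_trans (le_max_left _ _) (le_max_left _ _)) hX
  have hX4 : (4 : ℝ) ≤ X := le_trans (le_trans (le_max_right _ _) (le_max_left _ _)) hX
  have hXh : (h : ℝ) ≤ X := le_trans (le_max_right _ _) hX
  have hX0 : (0 : ℝ) < X := by linarith
  set N : ℕ := ⌊X⌋₊ with hNdef
  have hN₀ : N₀ ≤ N := Nat.le_floor hXN₀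
  have hhN : h ≤ N := Nat.le_floor hXh
  have h4N : 4 ≤ N := Nat.le_floor (by exact_mod_cast hX4)
  have hNX : (N : ℝ) ≤ X := Nat.floor_le hX0.le
  have hNge : X / 2 ≤ (N : ℝ) := by
    have := Nat.sub_one_lt_floor X
    rw [← hNdef] at this
    linarith
  have hN0 : (0 : ℝ) < N := by linarith
  -- the instance of LambdaLiouvilleLevel: residue `h`, height `N` for every modulus
  have key := hC N hN₀ (fun _ => h) (fun _ => N) (fun _ => le_rfl)
  -- (a) the inner sums agree
  have inner : ∀ q : ℕ,
      ∑ n ∈ (Finset.Icc 1 N).filter (fun n : ℕ => n ≡ h [MOD q]),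
          ArithmeticFunction.vonMangoldt n *
            (ArithmeticFunction.liouville (Int.toNat ((n : ℤ) + -(h : ℤ))) : ℝ) =
        ∑ n ∈ (Finset.Ioc h N).filter (fun n : ℕ => n ≡ h [MOD q]),
          ArithmeticFunction.vonMangoldt n * (ArithmeticFunction.liouville (n - h) : ℝ) := by
    intro q
    symm
    rw [← Finset.sum_subset (s₁ := (Finset.Ioc h N).filter (fun n : ℕ => n ≡ h [MOD q]))
      (s₂ := (Finset.Icc 1 N).filter (fun n : ℕ => n ≡ h [MOD q]))
      (f := fun n => ArithmeticFunction.vonMangoldt n *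
            (ArithmeticFunction.liouville (Int.toNat ((n : ℤ) + -(h : ℤ))) : ℝ))]
    · refine Finset.sum_congr rfl fun n hn => ?_
      have hn' : h < n := by
        have := (Finset.mem_filter.mp hn).1
        exact (Finset.mem_Ioc.mp this).1
      have hcast : ((n : ℤ) + -(h : ℤ)) = ((n - h : ℕ) : ℤ) := by
        push_cast [Nat.cast_sub hn'.le]; ring
      rw [hcast, Int.toNat_natCast]
    · intro n hn
      simp only [Finset.mem_filter, Finset.mem_Ioc, Finset.mem_Icc] at hn ⊢
      exact ⟨⟨by omega, hn.1.2⟩, hn.2⟩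
    · intro n hn hn'
      simp only [Finset.mem_filter, Finset.mem_Ioc, Finset.mem_Icc, not_and] at hn hn'
      have hle : n ≤ h := by
        by_contra hlt
        exact hn' ⟨lt_of_not_ge hlt, hn.1.2⟩ hn.2
      have hz : Int.toNat ((n : ℤ) + -(h : ℤ)) = 0 := by
        apply Int.toNat_of_nonpos; omega
      rw [hz, ArithmeticFunction.map_zero]
      simp
  -- (b) the level `X^{ε₀/2}` sits inside the level `N^{ε₀}`
  have hlevel : ⌊X ^ (2 * (ε₀ / 4))⌋₊ ≤ ⌊(N : ℝ) ^ ε₀⌋₊ := by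
    apply Nat.floor_le_floor
    have h2 : 2 * (ε₀ / 4) = ε₀ / 2 := by ring
    rw [h2]
    have hA1 : (2 : ℝ) ^ ε₀ = (4 : ℝ) ^ (ε₀ / 2) := by
      rw [show (4 : ℝ) = (2 : ℝ) ^ (2 : ℝ) by norm_num, ← Real.rpow_mul (by norm_num)]
      ring_nf
    have hA2 : (4 : ℝ) ^ (ε₀ / 2) ≤ X ^ (ε₀ / 2) :=
      Real.rpow_le_rpow (by norm_num) hX4 (by positivity)
    have hA3 : X ^ ε₀ = X ^ (ε₀ / 2) * X ^ (ε₀ / 2) := by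
      rw [← Real.rpow_add hX0]; ring_nf
    have hA4 : (X / 2) ^ ε₀ ≤ (N : ℝ) ^ ε₀ :=
      Real.rpow_le_rpow (by positivity) hNge hε₀.le
    have hA5 : (X / 2) ^ ε₀ = X ^ ε₀ / (2 : ℝ) ^ ε₀ := Real.div_rpow hX0.le (by norm_num) ε₀
    have h2pos : (0 : ℝ) < (2 : ℝ) ^ ε₀ := by positivity
    have hXe : (0 : ℝ) ≤ X ^ (ε₀ / 2) := by positivity
    calc X ^ (ε₀ / 2) = X ^ (ε₀ / 2) * (2 : ℝ) ^ ε₀ / (2 : ℝ) ^ ε₀ := by field_simp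
      _ ≤ X ^ (ε₀ / 2) * X ^ (ε₀ / 2) / (2 : ℝ) ^ ε₀ := by
          apply div_le_div_of_nonneg_right _ h2pos.le
          rw [hA1]
          exact mul_le_mul_of_nonneg_left hA2 hXe
      _ = (X / 2) ^ ε₀ := by rw [hA5, hA3]
      _ ≤ (N : ℝ) ^ ε₀ := hA4
  -- (c) the right-hand sides compare
  have hlogX : Real.log 4 ≤ Real.log X := Real.log_le_log (by norm_num) hX4
  have hlog4 : Real.log 4 = 2 * Real.log 2 := by
    rw [show (4 : ℝ) = 2 ^ 2 by norm_num, Real.log_pow]; push_cast; ring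
  have hlog2 : 0 < Real.log 2 := Real.log_pos (by norm_num)
  have hlogXpos : 0 < Real.log X := by linarith
  have hlogN : Real.log X / 2 ≤ Real.log N := by
    have h1 : Real.log (X / 2) ≤ Real.log N := Real.log_le_log (by positivity) hNge
    rw [Real.log_div hX0.ne' (by norm_num)] at h1
    linarith
  have hlogNpos : 0 < Real.log N := by linarith
  have hrhs : C * N / Real.log N ^ (6 : ℝ) ≤ 64 * max C 0 * X / Real.log X ^ (6 : ℝ) := by
    rw [show (6 : ℝ) = ((6 : ℕ) : ℝ) by norm_num, Real.rpow_natCast, Real.rpow_natCast]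
    have hpow : Real.log X ^ 6 / 64 ≤ Real.log N ^ 6 := by
      have := pow_le_pow_left₀ (by positivity : 0 ≤ Real.log X / 2) hlogN 6
      calc Real.log X ^ 6 / 64 = (Real.log X / 2) ^ 6 := by ring
        _ ≤ Real.log N ^ 6 := this
    have hnum : C * N ≤ max C 0 * X :=
      le_trans (mul_le_mul_of_nonneg_right (le_max_left C 0) hN0.le)
        (mul_le_mul_of_nonneg_left hNX (le_max_right C 0))
    calc C * N / Real.log N ^ 6 ≤ max C 0 * X / (Real.log X ^ 6 / 64) :=
          div_le_div₀ (by positivity) hnum (by positivity) hpow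
      _ = 64 * max C 0 * X / Real.log X ^ 6 := by
          field_simp
  -- assemble
  calc ∑ q ∈ Finset.Icc 1 ⌊X ^ (2 * (ε₀ / 4))⌋₊,
        |∑ n ∈ (Finset.Ioc h ⌊X⌋₊).filter (fun n => n ≡ h [MOD q]),
          ArithmeticFunction.vonMangoldt n * (ArithmeticFunction.liouville (n - h) : ℝ)|
      ≤ ∑ q ∈ Finset.Icc 1 ⌊(N : ℝ) ^ ε₀⌋₊,
        |∑ n ∈ (Finset.Ioc h N).filter (fun n => n ≡ h [MOD q]),
          ArithmeticFunction.vonMangoldt n * (ArithmeticFunction.liouville (n - h) : ℝ)| := by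
        apply Finset.sum_le_sum_of_subset_of_nonneg (Finset.Icc_subset_Icc_right hlevel)
        intro _ _ _; exact abs_nonneg _
    _ = ∑ q ∈ Finset.Icc 1 ⌊(N : ℝ) ^ ε₀⌋₊,
        |∑ n ∈ (Finset.Icc 1 N).filter (fun n : ℕ => n ≡ h [MOD q]),
          ArithmeticFunction.vonMangoldt n *
            (ArithmeticFunction.liouville (Int.toNat ((n : ℤ) + -(h : ℤ))) : ℝ)| := by
        refine Finset.sum_congr rfl fun q _ => ?_
        rw [inner q]
    _ ≤ C * N / Real.log N ^ (6 : ℝ) := key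
    _ ≤ 64 * max C 0 * X / Real.log X ^ (6 : ℝ) := hrhs

/-- **Conjunct 4 = item 14275.** Given the shared support item `PairsFromMAvg` of
LiouvilleShiftedTables (stmt-Parity-14275), `LevelToPairs` follows from the bridge and the tree
theorem `MAvg_of_sum_abs_vonMangoldt_mul_liouville_progressions_le` — no separate Murty–Vatwani
transposition is needed on this route. -/
theorem levelToPairs_of_pairsFromMAvg (hP : LiouvilleShiftedTables.PairsFromMAvg) : LevelToPairs :=
  fun hL hEH => hP (eh_iff_elliottHalberstam.mpr hEH)
    (Theorems.MAvg.MAvg_of_sum_abs_vonMangoldt_mul_liouville_progressions_le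
      (levelHypothesis_of_lambdaLiouvilleLevel hL))

end Summit.Parity.GeneralizedHardyLittlewood.Cruxes.EngineToGHL.GlueNowResidualByName
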